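import Literature.AlgebraicGeometry.ModuliOfAbelianVarieties.Lan2013.Sec41Sec42DegenerationData
import Literature.AlgebraicGeometry.ModuliOfAbelianVarieties.Lan2013.Sec43ThetaFourierExpansions
import HarnessLib

/-!
# [Lan2013] §4.3 ↔ §4.2 — the CHECKED bridge between the §4.3 relations and the `DD_ample` axioms of §4.2 (proof file, 0 new facts)

Companion to ★ `Lan2013/Sec43ThetaFourierExpansions.lean` (R3) and ★ `Lan2013/Sec41Sec42DegenerationData.lean` (R2)
[Lan2013PELCompactifications, §4.2.1–§4.2.4 (book pp. 176–190), §4.3.1 (pp. 190–196)].  Cor. 4.3.1.16 says that the `(φ, τ, ψ)` produced in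
§4.3.1 from `(G, L)` form an object of `DD_ample`; in the tree the §4.3 side is the LETTER datum `ThetaAmbient` with its REAL shadow fields
`Ipsi l m`, `Itau l m : … → (FractionalIdeal R⁰ K)ˣ`, and the §4.2 side is `DDampleData` with the shadow fields `Ipsi`, `Itau` of the SAME type
(`Inv R K`).  This file PROVES (closing referee label QA7-13 on R3): whenever a pair `(l, m)` of the ambient carries the shadows, the `φ` and
the ideal of a degeneration datum `𝔇 : DDampleData R I K X Y` (hypotheses `hI`, `hφ`, `hψ`, `hτ` — equalities, no new predicate), the §4.3
relations Prop. 4.3.1.9 (1), (3)-conclusion, (4), (5) and (4.3.1.12) at `(l, m)` ARE R2's (4.2.3.4) `Ipsi_rel`, (4.2.2.2) `ItauMulLeft`,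
(4.2.2.1) `ItauMulRight`, the second clause of Def. 4.2.1.11 `PositivityPsi` and the second clause of Def. 4.2.1.10 `PositivityTau` for `𝔇`
— pure bookkeeping in the commutative group `Inv(R)`, as print says («natural consequences of the definitions», Prop. 4.3.1.9).
No `def`, no new fact; kind proof.  HC_CM is proved only modulo the 7 printed citations (2 remaining: hLiu418 = stmt-HodgeConjecture-24832,
h413 = stmt-HodgeConjecture-24833) until rung 0 closes; this file discharges none of them.
-/

noncomputable section

open scoped nonZeroDivisors

universe v

namespace Literature.AlgebraicGeometry.ModuliOfAbelianVarieties.Lan2013.Sec43ThetaFourierExpansions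

open Sec41Sec42DegenerationData

variable {R : Type} [CommRing R] {I : Ideal R} {K : Type} [Field K] [Algebra R K]
  {X Y : Type} [AddCommGroup X] [AddCommGroup Y]
  {LIdx MIdx : Type v}
  {Gam : LIdx → Type v} [∀ l, AddCommGroup (Gam l)] [∀ l, Module K (Gam l)]
  {V : MIdx → Type v} [∀ m, AddCommGroup (V m)] [∀ m, Module K (V m)]
  {GM : MIdx → Type v} [∀ m, Group (GM m)]
  {GnatK AK Λ : Type v} [AddCommGroup GnatK] [AddCommGroup AK] [AddCommGroup Λ]
  {GS AS EndG : Type v}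
  {D : ThetaAmbient R K X Y LIdx MIdx Gam V GM GnatK AK Λ GS AS EndG} {𝔇 : DDampleData R I K X Y} {l : LIdx} {m : MIdx}

/-- **Prop. 4.3.1.9 (1) ⇒ (4.2.3.4)**: the shadow form `I_{y₁+y₂} = I_{y₁} I_{y₂} I_{y₁,φ(y₂)}` of (4.3.1.10) at a pair `(l, m)` carrying the
shadows of `𝔇` is R2's `Ipsi_rel` «`ψ(y₁+y₂) ψ(y₁)⁻¹ ψ(y₂)⁻¹ = τ(y₁, φ(y₂))`» for `𝔇` (commutativity of `Inv(R)`).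
[cite: Lan2013PELCompactifications, Prop. 4.3.1.9 (p. 193)] -/
theorem ipsi_rel_of_Lan2013_4319_1 (h : Lan2013_4319_1_psi_add D) (hl : D.IsAmpleL l) (hd : D.Descends l m)
    (hφ : D.φOf l = 𝔇.φ) (hψ : D.Ipsi l m = 𝔇.Ipsi) (hτ : D.Itau l m = 𝔇.Itau) : 𝔇.Ipsi_rel := by
  intro y₁ y₂
  have e := h l m hl hd y₁ y₂
  rw [hφ, hψ, hτ] at e
  rw [mul_inv_eq_iff_eq_mul, mul_inv_eq_iff_eq_mul, e]
  ac_rfl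

/-- **(4.3.1.12) ⇒ (4.2.2.1)**: multiplicativity of `τ` in `χ` (proved on rev. pp. 235–236) at `(l, m)` is R2's `ItauMulRight` for `𝔇`.
[cite: Lan2013PELCompactifications, (4.3.1.12) (pp. 194, 208)] -/
theorem itauMulRight_of_Lan2013_43112 (h : Lan2013_43112_tau_mult_chi D) (hl : D.IsAmpleL l) (hd : D.Descends l m)
    (hτ : D.Itau l m = 𝔇.Itau) : 𝔇.ItauMulRight := by
  intro y χ₁ χ₂
  have e := h l m hl hd y χ₁ χ₂
  rwa [hτ] at e

/-- **Prop. 4.3.1.9 (3) ⇒ (4.2.2.2)**: given (4.3.1.12), the conclusion (4.3.1.13) (multiplicativity of `τ` in `y`) at `(l, m)` is R2's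
`ItauMulLeft` for `𝔇`. [cite: Lan2013PELCompactifications, Prop. 4.3.1.9 (pp. 193–194)] -/
theorem itauMulLeft_of_Lan2013_4319_3 (h : Lan2013_4319_3_tau_bimult D) (h12 : Lan2013_43112_tau_mult_chi D) (hl : D.IsAmpleL l)
    (hd : D.Descends l m) (hτ : D.Itau l m = 𝔇.Itau) : 𝔇.ItauMulLeft := by
  intro y₁ y₂ χ
  have e := h l m hl hd (h12 l m hl hd) y₁ y₂ χ
  rwa [hτ] at e

/-- **Prop. 4.3.1.9 (4) ⇒ Def. 4.2.1.11, second clause**: «for any integer `n > 0`, for all but finitely many `y ∈ Y`, `ψ(y)` … is congruent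
to zero modulo `I^n`» at `(l, m)` is the finiteness clause of R2's `PositivityPsi` for `𝔇` (its first clause, «every `ψ(y)` extends», is
Def. 4.2.1.11's own and is not part of Prop. 4.3.1.9 (4) as printed). [cite: Lan2013PELCompactifications, Prop. 4.3.1.9 (p. 194)] -/
theorem positivityPsi_finite_of_Lan2013_4319_4 (h : Lan2013_4319_4_psi_positivity D) (hl : D.IsAmpleL l) (hd : D.Descends l m)
    (hI : D.I = I) (hψ : D.Ipsi l m = 𝔇.Ipsi) :
    ∀ n : ℕ, 1 ≤ n → {y : Y | ¬ (𝔇.Ipsi y : FractionalIdeal R⁰ K) ≤ ((I ^ n : Ideal R) : FractionalIdeal R⁰ K)}.Finite := by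
  intro n hn
  have e := h l m hl hd n hn
  rwa [hI, hψ] at e

/-- … and together with the «extends» clause it IS `PositivityPsi`. [cite: Lan2013PELCompactifications, Prop. 4.3.1.9 (p. 194)] -/
theorem positivityPsi_of_Lan2013_4319_4 (h : Lan2013_4319_4_psi_positivity D) (hl : D.IsAmpleL l) (hd : D.Descends l m)
    (hI : D.I = I) (hψ : D.Ipsi l m = 𝔇.Ipsi) (hext : ∀ y : Y, (𝔇.Ipsi y : FractionalIdeal R⁰ K) ≤ 1) : 𝔇.PositivityPsi :=
  ⟨hext, positivityPsi_finite_of_Lan2013_4319_4 h hl hd hI hψ⟩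

/-- **Prop. 4.3.1.9 (5) ⇒ Def. 4.2.1.10**: «for all nonzero `y`, `τ(y, φ(y))` extends … and is congruent to zero modulo `I`» at `(l, m)`
gives R2's `PositivityTau` for `𝔇` once the `y = 0` instance of its first clause (`I_{0,φ(0)} ⊆ R`, which is Lem. 4.3.1.8 (2): `I_{0,χ} =
R`) is supplied — here from `Lan2013_4318_normalisations`. [cite: Lan2013PELCompactifications, Prop. 4.3.1.9 (p. 194)] -/
theorem positivityTau_of_Lan2013_4319_5 (h : Lan2013_4319_5_tau_positivity D) (h8 : Lan2013_4318_normalisations D)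
    (hl : D.IsAmpleL l) (hd : D.Descends l m) (hI : D.I = I) (hφ : D.φOf l = 𝔇.φ) (hτ : D.Itau l m = 𝔇.Itau) :
    𝔇.PositivityTau := by
  refine ⟨fun y => ?_, fun y hy => ?_⟩
  · by_cases hy : y = 0
    · subst hy
      have e := (h8 l m hl hd).2.1 (𝔇.φ 0)
      rw [hτ] at e
      rw [e]
      simp
    · have e := (h l m hl hd y hy).1
      rwa [hφ, hτ] at e
  · have e := (h l m hl hd y hy).2
    rwa [hI, hφ, hτ] at e

/-- **Conversely, Def. 4.2.1.10 ⇒ Prop. 4.3.1.9 (5) at `(l, m)`**: R2's `PositivityTau` for `𝔇` gives both printed clauses of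
Prop. 4.3.1.9 (5) for the pair carrying its shadows (the «extends» clause `≤ 1` and `≤ I`).
[cite: Lan2013PELCompactifications, Prop. 4.3.1.9 (p. 194)] -/
theorem Lan2013_4319_5_at_of_positivityTau (h : 𝔇.PositivityTau) (hI : D.I = I) (hφ : D.φOf l = 𝔇.φ) (hτ : D.Itau l m = 𝔇.Itau) :
    ∀ y : Y, y ≠ 0 →
      (D.Itau l m y (D.φOf l y) : FractionalIdeal R⁰ K) ≤ 1 ∧
        (D.Itau l m y (D.φOf l y) : FractionalIdeal R⁰ K) ≤ (D.I : FractionalIdeal R⁰ K) := by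
  intro y hy
  rw [hI, hφ, hτ]
  exact ⟨h.1 y, h.2 y hy⟩

end Literature.AlgebraicGeometry.ModuliOfAbelianVarieties.Lan2013.Sec43ThetaFourierExpansions
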